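import Summits.Ventures.AbcSig.Rows.TemplateAB
import Summits.Ventures.AbcSig.Levels.N502
import Summits.Ventures.AbcSig.Levels.N8032

/-!
# Venture AbcSig — ROW `C2aL251A3AB`: `251^m·xⁿ + 2^a·yⁿ = z²` (SECOND coefficient distribution of the cell; the distribution `xⁿ + 2^a·251^m·yⁿ = z²` is `Rows/C2aL251A3.lean`), class `a 3` (GENERATED by plean/leanrow.py)

HONEST FRAMING. A row of a COMPUTATION cell (`pub-abcsig`); a CONDITIONAL theorem, no claim on ABC or any summit.
Hypotheses: `BS04Package` (CITED), `DataComplete` at levels [502, 8032] (COMPUTED, two-engine certified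
level files), and the listed per-orbit exclusions `hX_…` (CITED; the
row's R5 cell names each). Everything else is kernel-checked (`Rows/TemplateAB.lean`, `Levels/N….lean` — the SAME level files as the first distribution). Exponent
range: prime `n ≥ 11`, `n ≠ 251`, n ∉ [11]; `B = 2^a 251^m` with `a, m < n` (n-th-power free).
Row of record: `census/rows/C2a/C2a-l251-a3.md` (sha256 `93e2373f042cb3c0…`; SIGNED 2026-08-22T17:51:55Z by referee (ref-g14)); its R0: THEOREM for primes n >= 11, n not in [11]; the survivors [11] need M4 (Kraus) / stay open — class: candidate (a ∈ {0,3} cell, BATCH-03; lit/COVERAGE §C2 + I–K 2. Exponents left open by the row of record are excluded here via `hres`; kernel-sieve residuals the row of record closes by a cell module (M6 Eisenstein / M4 Kraus certificates) appear as CITED hypotheses `hX_…`.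
-/

namespace Summit.Ventures.AbcSig

/-- Row `C2aL251A3AB`: second coefficient distribution `251^m·xⁿ + 2^a·yⁿ = z²` (see module docstring). -/
theorem row_C2aL251A3AB (M : NewformModel) (hP : M.BS04Package)
    (hD502 : M.DataComplete 502 level502Orbits) (hD8032 : M.DataComplete 8032 level8032Orbits)
    (n : ℕ) (hn : n.Prime) (hmin : 11 ≤ n) (hnℓ : n ≠ 251) (hres : n ∉ ([11] : List ℕ)) (m : ℕ) (hm : 1 ≤ m) (hmn : m < n)
    
    (x y z : ℤ) (hxy1 : x * y ≠ 1) (hxy2 : x * y ≠ -1) : ¬ IsPrimitiveSolution (251 ^ m) (2 ^ 3) 1 n x y z := by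
  have hℓ : Nat.Prime 251 := by norm_num
  have h7 : 7 ≤ n := by omega
  have hS502 :=
    (level502_sieve n hn h7 (fun o => M.Excludes 502 o (famAB (251 ^ m) (2 ^ 3) n (fun _ _ => True))) (fun h => absurd h (by simp only [List.mem_cons, List.not_mem_nil, or_false] at hres ⊢; omega)) (fun h => absurd h (by simp only [List.mem_cons, List.not_mem_nil, or_false] at hres ⊢; omega)))
  have hS8032 :=
    (level8032_sieve n hn h7 (fun o => M.Excludes 8032 o (famAB (251 ^ m) (2 ^ 3) n (fun _ _ => True))) (fun h => absurd h (by simp only [List.mem_cons, List.not_mem_nil, or_false] at hres ⊢; omega)) (fun h => absurd h (by simp only [List.mem_cons, List.not_mem_nil, or_false] at hres ⊢; omega)) (fun h => absurd h (by simp only [List.mem_cons, List.not_mem_nil, or_false] at hres ⊢; omega)) (fun h => absurd h (by simp only [List.mem_cons, List.not_mem_nil, or_false] at hres ⊢; omega)) (fun h => absurd h (by simp only [List.mem_cons, List.not_mem_nil, or_false] at hres ⊢; omega)) (fun h => absurd h (by simp only [List.mem_cons, List.not_mem_nil, or_false] at hres ⊢; omega)) (fun h => absurd h (by simp only [List.mem_cons,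 List.not_mem_nil, or_false] at hres ⊢; omega)) (fun h => absurd h (by simp only [List.mem_cons, List.not_mem_nil, or_false] at hres ⊢; omega)) (fun h => absurd h (by simp only [List.mem_cons, List.not_mem_nil, or_false] at hres ⊢; omega)) (fun h => absurd h (by simp only [List.mem_cons, List.not_mem_nil, or_false] at hres ⊢; omega)))
  exact rowC2aAB_a3 251 hℓ (by norm_num) M hP n hn h7 hnℓ hD8032 hD502 m hm hmn
    hS8032
    hS502 x y z hxy1 hxy2

end Summit.Ventures.AbcSig
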